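import Mathlib.LinearAlgebra.Lagrange
import Mathlib.Algebra.MvPolynomial.Equiv
import Mathlib.Algebra.CharZero.Defs
import Literature.Computability.AlgebraicComplexity.ArithCircuitProofs
import Literature.Computability.AlgebraicComplexity.IMMInVPProofs
import HarnessLib

/-!
# Coefficient extraction by interpolation: the coefficient functions of a polynomial with small
# circuits have circuits of size `(d+1)^n · (L + 2)`

Topic `Computability/AlgebraicComplexity`. Let `Γ(x, y) ∈ F[x_1..x_n, y]` have `x`-degrees `≤ d`
and circuit complexity `L(Γ)`. Its coefficient of `x^m`, a polynomial in `y`, is the linear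
combination `Σ_{α ∈ {0..d}^n} (∏_i λ_{m_i, α_i}) · Γ(α, y)` of `(d+1)^n` specialisations, where
`λ_{j,a}` are the dual Vandermonde (Lagrange) coefficients of the nodes `0, …, d` — tensor-product
Lagrange interpolation (Bürgisser 2000, the interpolation argument of Prop. 2.10 / Lemma 2.14 type;
Forbes–Shpilka–Volk 2018, Lemma 14 "by interpolation"). Hence
`L([x^m] Γ) ≤ (d+1)^n (L(Γ) + 2)`: substitutions are free (Bürgisser Rem. 2.7, tree
`complexity_aeval_le`). For `d = n` this is `2^{O(n log n)}`, below the `2^{n²}`-type hardness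
used by the planting obstructions of the cell `valiant-natproofs` (the planners' `CoefficientFunctionsEasy`
/ `GeneralPlantingObstruction`); the sharper `poly(N)` bound by truncated arithmetic is not attempted.

* `vandermondeDual F d j a` — coefficient of `t^j` in the Lagrange basis polynomial of the node `a`
  on `{0, …, d}`; `sum_vandermondeDual_mul_pow` — `Σ_a λ_{j,a} a^e = [j = e]` (`e ≤ d`).
* `coeff_eq_sum_smul_eval` — the interpolation identity for `P ∈ R[x_1..x_n]` over any
  commutative `F`-algebra `R`, individual degrees `≤ d`.
* `coeff_sumAlgEquiv_eq_sum` — the same for `[x^m] Γ`, `Γ ∈ F[x ⊕ y]`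
  (`MvPolynomial.sumAlgEquiv`), and `complexity_coeff_sumAlgEquiv_le`.

Characteristic zero (distinct integer nodes).

## References

* [Burgisser2000] P. Bürgisser, *Completeness and Reduction in Algebraic Complexity Theory*,
  Springer 2000, Rem. 2.7 (substitution), §2.1 (interpolation arguments).
* [ForbesShpilkaVolk2018] M. A. Forbes, A. Shpilka, B. L. Volk, *Succinct hitting sets and
  barriers to proving lower bounds for algebraic circuits*, Theory Comput. 14 (2018), Lemma 14
  (interpolation of generator outputs).
-/

noncomputable section

namespace Literature.Computability.AlgebraicComplexity

open MvPolynomial Finset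

/-! ### Dual Vandermonde coefficients -/

section Dual

variable (F : Type*) [Field F] [CharZero F]

/-- The dual Vandermonde coefficient `λ_{d,j,a}`: the coefficient of `t^j` in the Lagrange basis
polynomial of the node `a` on the nodes `{0, …, d} ⊆ F`. [cite: Burgisser2000, §2.1] -/
def vandermondeDual (d j a : ℕ) : F :=
  (Lagrange.basis (Finset.range (d + 1)) (fun a : ℕ => (a : F)) a).coeff j

omit [CharZero F] in
/-- The integer nodes are distinct in characteristic zero. [folklore] -/
private theorem natCast_injOn [CharZero F] (d : ℕ) :
    Set.InjOn (fun a : ℕ => (a : F)) (Finset.range (d + 1) : Set ℕ) :=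
  fun _ _ _ _ h => Nat.cast_injective h

/-- **Duality**: `Σ_{a ≤ d} λ_{j,a} a^e = [j = e]` for `e ≤ d` (compare the `t^j`-coefficients in
the Lagrange interpolation identity `t^e = Σ_a a^e ℓ_a(t)`). [cite: Burgisser2000, §2.1] -/
theorem sum_vandermondeDual_mul_pow (d : ℕ) {e : ℕ} (he : e ≤ d) (j : ℕ) :
    ∑ a ∈ Finset.range (d + 1), vandermondeDual F d j a * (a : F) ^ e =
      if j = e then 1 else 0 := by
  have hdeg : ((Polynomial.X : Polynomial F) ^ e).degree < (Finset.range (d + 1)).card := by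
    rw [Polynomial.degree_X_pow, Finset.card_range]
    exact_mod_cast Nat.lt_succ_of_le he
  have h := Lagrange.eq_interpolate (v := fun a : ℕ => (a : F)) (natCast_injOn F d) hdeg
  have hc := congrArg (fun q : Polynomial F => q.coeff j) h
  simp only [Polynomial.coeff_X_pow, Lagrange.interpolate_apply, Polynomial.finsetSum_coeff,
    Polynomial.coeff_C_mul, Polynomial.eval_pow, Polynomial.eval_X] at hc
  rw [hc]
  refine Finset.sum_congr rfl fun a _ => ?_
  rw [vandermondeDual, mul_comm]

end Dual

/-! ### The interpolation identity -/

section Identity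

variable {F : Type*} [Field F] [CharZero F] {R : Type*} [CommRing R] [Algebra F R]

/-- The tensor duality: `Σ_α (∏_i λ_{m_i, α_i}) ∏_i α_i^{s_i} = [m = s]` on `{0..d}^n`.
[cite: Burgisser2000, §2.1] -/
theorem sum_prod_vandermondeDual_mul_prod_pow {n d : ℕ} (m s : Fin n →₀ ℕ)
    (hs : ∀ i, s i ≤ d) :
    ∑ α : Fin n → Fin (d + 1), (∏ i, vandermondeDual F d (m i) (α i)) * ∏ i, ((α i : ℕ) : F) ^ s i =
      if m = s then 1 else 0 := by
  classical
  have h1 : ∀ α : Fin n → Fin (d + 1),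
      (∏ i, vandermondeDual F d (m i) (α i)) * ∏ i, ((α i : ℕ) : F) ^ s i =
        ∏ i, (vandermondeDual F d (m i) (α i) * ((α i : ℕ) : F) ^ s i) := fun α =>
    (Finset.prod_mul_distrib).symm
  simp_rw [h1]
  rw [← Fintype.prod_sum (fun i (a : Fin (d + 1)) => vandermondeDual F d (m i) a * ((a : ℕ) : F) ^ s i)]
  have h2 : ∀ i : Fin n, ∑ a : Fin (d + 1), vandermondeDual F d (m i) a * ((a : ℕ) : F) ^ s i =
      if m i = s i then 1 else 0 := by
    intro i
    rw [Fin.sum_univ_eq_sum_range (fun a => vandermondeDual F d (m i) a * ((a : ℕ) : F) ^ s i) (d + 1)]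
    exact sum_vandermondeDual_mul_pow F d (hs i) (m i)
  simp_rw [h2]
  by_cases hms : m = s
  · subst hms; simp
  · rw [if_neg hms]
    obtain ⟨i, hi⟩ : ∃ i, m i ≠ s i := by
      by_contra hcon; push Not at hcon; exact hms (Finsupp.ext hcon)
    exact Finset.prod_eq_zero (Finset.mem_univ i) (if_neg hi)

/-- **Coefficient extraction by interpolation** over a commutative `F`-algebra `R`: for
`P ∈ R[x_1..x_n]` with all exponents `≤ d`, `[x^m] P = Σ_{α ∈ {0..d}^n} (∏_i λ_{m_i,α_i}) · P(α)`
(for every `m`; both sides vanish when some `m_i > d`).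
[cite: Burgisser2000, §2.1] -/
theorem coeff_eq_sum_smul_eval {n d : ℕ} (P : MvPolynomial (Fin n) R)
    (hd : ∀ s ∈ P.support, ∀ i, s i ≤ d) (m : Fin n →₀ ℕ) :
    coeff m P = ∑ α : Fin n → Fin (d + 1),
      (∏ i, vandermondeDual F d (m i) (α i)) • eval (fun i => ((α i : ℕ) : R)) P := by
  classical
  simp_rw [eval_eq' _ P, Finset.smul_sum, Algebra.smul_def, map_prod]
  rw [Finset.sum_comm]
  have key : ∀ s ∈ P.support,
      ∑ α : Fin n → Fin (d + 1), (∏ i, algebraMap F R (vandermondeDual F d (m i) (α i))) *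
        (coeff s P * ∏ i, ((α i : ℕ) : R) ^ s i) =
      coeff s P * algebraMap F R (if m = s then 1 else 0) := by
    intro s hs
    rw [← sum_prod_vandermondeDual_mul_prod_pow m s (hd s hs), map_sum, Finset.mul_sum]
    refine Finset.sum_congr rfl fun α _ => ?_
    rw [map_mul, map_prod, map_prod]
    simp only [map_pow, map_natCast]
    ring
  rw [Finset.sum_congr rfl key]
  simp_rw [apply_ite (algebraMap F R), map_one, map_zero, mul_ite, mul_one, mul_zero]
  rw [Finset.sum_ite_eq]
  split_ifs with h
  · rfl
  · exact (notMem_support_iff.1 h)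

end Identity

/-! ### The coefficient functions of `Γ(x, y)` and their complexity -/

section Extraction

variable {F : Type*} [Field F] [CharZero F] {τ : Type*} {n d : ℕ}

omit [CharZero F] in
/-- Specialising the `x`-block of `Γ(x, y)` at the integer point `α` is evaluation of
`sumAlgEquiv Γ ∈ (F[y])[x]` at the constants `α`. [cite: Burgisser2000, Rem. 2.7] -/
theorem eval_sumAlgEquiv_natCast (Γ : MvPolynomial (Fin n ⊕ τ) F) (α : Fin n → Fin (d + 1)) :
    eval (fun i => (C ((α i : ℕ) : F) : MvPolynomial τ F)) (sumAlgEquiv F (Fin n) τ Γ) =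
      aeval (Sum.elim (fun i => C ((α i : ℕ) : F)) X) Γ := by
  have key : (eval (fun i => (C ((α i : ℕ) : F) : MvPolynomial τ F))).comp
        (sumAlgEquiv F (Fin n) τ).toRingEquiv.toRingHom =
      (aeval (Sum.elim (fun i => C ((α i : ℕ) : F)) X) :
        MvPolynomial (Fin n ⊕ τ) F →ₐ[F] MvPolynomial τ F).toRingHom := by
    refine MvPolynomial.ringHom_ext (fun r => ?_) (fun v => ?_)
    · simp only [RingHom.coe_comp, Function.comp_apply, RingEquiv.toRingHom_eq_coe,
        RingEquiv.coe_toRingHom, AlgEquiv.coe_ringEquiv,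
        AlgHom.toRingHom_eq_coe, AlgHom.coe_toRingHom, aeval_C, algebraMap_eq]
      rw [sumAlgEquiv_C_inl, eval_C]
    · rcases v with i | j
      · simp only [RingHom.coe_comp, Function.comp_apply, RingEquiv.toRingHom_eq_coe,
          RingEquiv.coe_toRingHom, AlgEquiv.coe_ringEquiv,
          AlgHom.toRingHom_eq_coe, AlgHom.coe_toRingHom, aeval_X, Sum.elim_inl]
        rw [sumAlgEquiv_X_inl, eval_X]
      · simp only [RingHom.coe_comp, Function.comp_apply, RingEquiv.toRingHom_eq_coe,
          RingEquiv.coe_toRingHom, AlgEquiv.coe_ringEquiv,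
          AlgHom.toRingHom_eq_coe, AlgHom.coe_toRingHom, aeval_X, Sum.elim_inr]
        rw [sumAlgEquiv_X_inr, eval_C]
  have := RingHom.congr_fun key Γ
  simpa using this

/-- **`[x^m] Γ(x,y) = Σ_α (∏ λ) · Γ(α, y)`** for `Γ` with `x`-degrees `≤ d`.
[cite: Burgisser2000, §2.1] -/
theorem coeff_sumAlgEquiv_eq_sum (Γ : MvPolynomial (Fin n ⊕ τ) F)
    (hd : ∀ i, degreeOf i (sumAlgEquiv F (Fin n) τ Γ) ≤ d) (m : Fin n →₀ ℕ) :
    coeff m (sumAlgEquiv F (Fin n) τ Γ) = ∑ α : Fin n → Fin (d + 1),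
      C (∏ i, vandermondeDual F d (m i) (α i)) * aeval (Sum.elim (fun i => C ((α i : ℕ) : F)) X) Γ := by
  rw [coeff_eq_sum_smul_eval (F := F) (sumAlgEquiv F (Fin n) τ Γ)
    (fun s hs i => (monomial_le_degreeOf i hs).trans (hd i)) m]
  refine Finset.sum_congr rfl fun α _ => ?_
  rw [smul_eq_C_mul, ← eval_sumAlgEquiv_natCast Γ α]
  rfl

/-- **The coefficient functions are cheap**: `L([x^m] Γ) ≤ (d+1)^n · (L(Γ) + 2)` (each
specialisation `Γ(α, y)` is a projection of `Γ`, Bürgisser Rem. 2.7; `(d+1)^n` of them, one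
scalar and one addition each). [cite: Burgisser2000, Rem. 2.7] -/
theorem complexity_coeff_sumAlgEquiv_le [Fintype τ] (Γ : MvPolynomial (Fin n ⊕ τ) F)
    (hd : ∀ i, degreeOf i (sumAlgEquiv F (Fin n) τ Γ) ≤ d) (m : Fin n →₀ ℕ) :
    complexity (coeff m (sumAlgEquiv F (Fin n) τ Γ)) ≤ (d + 1) ^ n * (complexity Γ + 2) := by
  rw [coeff_sumAlgEquiv_eq_sum Γ hd m]
  refine (complexity_finset_sum_le _ _).trans ?_
  have hcard : (Finset.univ : Finset (Fin n → Fin (d + 1))).card = (d + 1) ^ n := by simp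
  have hterm : ∀ α : Fin n → Fin (d + 1),
      complexity (C (∏ i, vandermondeDual F d (m i) (α i)) *
        aeval (Sum.elim (fun i => C ((α i : ℕ) : F)) X) Γ) ≤ complexity Γ + 1 := by
    intro α
    refine (complexity_mul_le_holds _ _).trans ?_
    rw [complexity_C_holds, zero_add]
    refine Nat.add_le_add_right ((complexity_aeval_le _ _).trans ?_) _
    rw [Finset.sum_eq_zero, add_zero]
    rintro (i | j) -
    · exact complexity_C_holds _
    · exact complexity_X_holds (k := F) j
  calc _ ≤ ∑ _α : Fin n → Fin (d + 1), (complexity Γ + 1) +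
        (Finset.univ : Finset (Fin n → Fin (d + 1))).card := by
        gcongr with α; exact hterm α
    _ = (d + 1) ^ n * (complexity Γ + 2) := by
        rw [Finset.sum_const, smul_eq_mul, hcard]; ring

end Extraction

end Literature.Computability.AlgebraicComplexity

end
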